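import Mathlib.Tactic.Linarith
import Mathlib.Tactic.Ring
import Mathlib.Tactic.NormNum
import Mathlib.Tactic.Positivity
import Mathlib.Tactic.FieldSimp
import Mathlib.Tactic.IntervalCases
import HarnessLib

/-!
# Secant versus tangent sheaves one rung up: the numerology of secant threefolds in an abelian fivefold (Weil tenfolds)

Family `hodge`, layer `Literature/AlgebraicGeometry/HodgeTheory`. Companion to `SemiregularityWeakCriterion.lean`,
`SemiregularityThetaNodeObstruction.lean`, `SemiregularityEulerFormBarrier.lean` / `…Sieve.lean` (ladder note
`papers/HodgeConjecture/hodge-weil-ladder`, section "Tenfold census"). Those files showed that Markman's certification tool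
[`Markman2025SecantWeil`, Lemma 8.3.4] is void on abelian FOURFOLDS (Euler-form barrier) but numerically available again on abelian
FIVEFOLDS (`n = 5`, Weil TENFOLDS `X × X̂`): the present file records the elementary arithmetic of that rung. Everything here is a
fully PROVED identity / inequality between rational or integer numbers; the algebraic geometry is in the docstrings.

Dictionary. `(P, Ξ)` a principally polarized abelian fivefold (`Ξ⁵ = 120`, minimal classes `Ξ^k/k!`), `K = ℚ(√-d)`, `d > 0`;
the `K`-secant plane is spanned by `α, β` with `exp(√-d Ξ) = α + √-d β`, i.e. `α + aβ` has coordinates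
`c = (1, a, −d, −ad, d², ad²)` in the basis `Ξ^k/k!` [`Markman2025SecantWeil`, §8.1; tree: `secantSystem_iff`]. A rank-one secant
design is `F = 𝓘_V ⊗ 𝒪(aΞ) ⊗ (Pic⁰)`, `V ⊂ P` a Cohen–Macaulay THREEFOLD (codimension 2 ⟺ `pd 𝓘_V ≤ 1` ⟺ no local Poisson
obstruction, tree `liftedMap_injective` / `coker_liftedMap_flat`), and `ch(F) = α + aβ` forces
`ch(𝒪_V) = 1 − e^{−aΞ}(α + aβ) = (s/2)Ξ² − (as/3)Ξ³ + (s(3a²−d)/24)Ξ⁴ − (as(a²−d)/30)Ξ⁵`, `s := a² + d`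
(§1 below; the surface case `Ξ⁵ = 0` is gen-2's Theorem G). With Grothendieck–Riemann–Roch for a smooth `i : V ↪ P`
(`td P = 1`, `ch(i_*𝒪_V) = i_*(td N)⁻¹ = i_*(1 − K/2 + (2K² − c₂N)/12 − K·c₂(T_V)/24)`, `K = K_V = c₁(N)`, `i_*c₂(N) = [V]²`):
`[V] = (s/2)Ξ²`, `i_*K_V = (2as/3)Ξ³`, `deg_Ξ V = 60s`, `K_V·Ξ² = 80as`, `K_V²·Ξ = 30s(3a²−d) + 15s²`, `χ(𝒪_V) = 4as(d − a²)`.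

## What is proved

* §1 `secantTwist_deg2 … deg5`: the convolution identities giving `e^{−aΞ}(α+aβ)`, and the numerical dictionary
  (`secantThreefold_degree/_canonicalDegree/_chi/_KsqXi`).
* §2 geography for a SMOOTH `V` in a SIMPLE `P` (then `V` is minimal of general type, `K_V = det N_V` nef and big, and Miyaoka's
  inequality `K_V·c₂(V) ≥ K_V³/3 > 0`, i.e. `χ(𝒪_V) < 0` [`Miyaoka1987ChernClasses`, Thm 1.1 / §6]): `a ≥ 1` (`K_V·Ξ² > 0`), then
  `d ≤ a² − 1`, hence `a ≥ 2`, `s ≥ 5`, `s ≠ 8`, `s = 16 ⟹ (a,d) = (3,7)`, `s = 32 ⟹ (a,d) = (5,7)`: Beauville's special threefolds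
  (classes `2^{e−7}·Ξ²/…`, `s = 2^{e−7}`) can be `K`-secant for a smooth design only through the Ramanujan–Nagell solutions
  `a² + 7 = 2^m` — the hub's crux field `ℚ(√-7)` once more (`ramanujanNagell_instances`).
* §3 the TANGENT identity: `ch(𝒪_{W_{g−2}}) = 1 − e^{−θ}(1+θ)` on any Jacobian (the `c = 2` case of
  `ch(𝒪_{W_{g−c}}) = Σ_{k ≥ c} (−1)^{k−c} C(k−1,c−1) θ^k/k!`, obtained from Macdonald's `c_t(C_d) = (1+xt)^{d−g+1}e^{−θt/(1+xt)}`
  [`ArbarelloEtAl1985`, VII §5] by Grothendieck–Riemann–Roch for `C_d → W_d` and Kempf's `R u_*𝒪 = 𝒪_{W_d}`; checked symbolically for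
  all `2 ≤ g ≤ 7` and `(g,d) = (11,9)` in the ladder note), hence `ch(𝓘_{W_{g−2}}(Θ)) = 1 + θ` — the TANGENT line to the spinor curve
  `{e^{zθ}}` at `z = 0`, i.e. the degenerate member `d = 0` of the secant family (`tangent_identity_deg2 … deg5`). Markman's genus-3
  sheaf `𝓘_{∪_{i ≤ d+1} C_i}(Θ)` is the sum of `d + 1` DISJOINT tangent objects. One rung up the tangent object is the Prym–Brill–Noether
  threefold `V₉ = W̃₉ ∩ P` (`g̃ = 11`, `θ̃|_P = 2Ξ`): `ch(𝒪_{V₉}) = 1 − e^{−2Ξ}(1+2Ξ) = 2Ξ² − (8/3)Ξ³ + 2Ξ⁴ − (16/15)Ξ⁵`, which is the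
  required secant character exactly at `(a,d) = (2,0)` and for NO `d > 0` (`prymBN_threefold_tangent`, `prymBN_threefold_not_secant`).
* §4 the Cohen–Macaulay disjointness count: two generic translates of codimension-2 subvarieties of an abelian `n`-fold meet in
  dimension `2(n−2) − n = n − 4`, while a Cohen–Macaulay union must be connected in codimension 1 [`Hartshorne1962`], i.e. meet in
  dimension `≥ n − 3`: impossible for `n ≥ 4`, vacuous (disjoint translates) for `n ≤ 3` (`cm_union_needs_le_three`,
  `translates_disjoint_iff_le_three`) — the structural reason the recipe "secant = sum of disjoint tangents" is special to genus 3;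
  and the count Lemma 8.3.4 asks of an irreducible design at `n = 5`: `e₂ = dim HT²(P) − n² = 20`, i.e. `h¹(N_V) − rk d₂ = 10`
  (`lemma834_count_five`).

* §5 (appended) the FULL rational design space. The secant plane is attached to the CM structure `η_w`, `w = u + iv ∈ K ∖ ℚ`,
  through the pure spinors `e^{wΞ}, e^{w̄Ξ}`; all `η_w` are conjugate under rational Hodge self-isogenies of `X × X̂` (B-field shear
  by `uΞ`, scaling of `X̂`), so every `w` yields the same rung up to isogeny, but the SHEAF condition `ch(F) ∈ B_w` depends on `w`:
  for `F = 𝓘_V(aΞ)` one gets `ch(𝒪_V) = 1 − e^{−a'Ξ}(α_{d'} + a'β_{d'})` with `a' = a − u ∈ ℚ`, `d' = v² ∈ ℚ_{>0}`,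
  `ℚ(√-d') = K` — §§1–2 hold verbatim with `(a', d')` rational. Integrality of `c₂, …, c₅(𝓘_V)` (units `Ξ^k/k!`:
  `s, 4a's, 3s² + 6s(3a'²−d'), 40a's² + 96a's(a'²−d')`) and of `χ(𝒪_V) = 4a's(d'−a'²)`, with `a'² < s < 2a'²`, leave NO design with
  `s ≤ 2` and exactly one each with `s = 3` (`(a',d') = (3/2, 3/4)`, `K = ℚ(√-3)`, principal plane `w ≡ ω₃`) and `s = 4`
  (`(3/2, 7/4)`, `K = ℚ(√-7)`, principal plane `w ≡ ω₇`; the class `2Ξ²` of the Prym–Brill–Noether threefold, which however has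
  `i_*K = 32·(Ξ³/6)`, `χ = −128` instead of the required `24·(Ξ³/6)`, `−12`) — `rationalDesign_*` below; the gens-2/4 planes
  `B_{√-dΘ}`, `B_{ωΘ}` are the conductor-1 principal classes of this family (other ideal classes occur: `s = 4`, `(7/4, 15/16)`,
  `K = ℚ(√-15)`, non-principal form `2x² − xy + 2y²`, passes `c`-integrality for surfaces but fails `χ ∈ ℤ` for threefolds).

No case of the Hodge conjecture is proved here; this is census arithmetic for the tenfold rung.
-/

namespace Literature.AlgebraicGeometry.HodgeTheory

section SecantTwist

/-- Degree-2 coordinate (basis `Ξ^k/k!`) of `e^{−aΞ}(α + aβ)`: `c₂ + 2c₁(−a) + c₀a² = −(a² + d) = −s`, so `ch₂(𝒪_V) = (s/2)Ξ²`,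
`[V] = s·(Ξ²/2)` = `s` minimal classes. [cite: Markman2025SecantWeil, §8.1] -/
theorem secantTwist_deg2 (a d : ℚ) : (-d) + 2 * a * (-a) + 1 * a ^ 2 = -(a ^ 2 + d) := by ring

/-- Degree-3 coordinate: `c₃ + 3c₂(−a) + 3c₁a² + c₀(−a)³ = 2a(a²+d)`, so `ch₃(𝒪_V) = −(as/3)Ξ³` and, by GRR (`ch₃(i_*𝒪_V) = −i_*K_V/2`),
`i_*K_V = (2as/3)Ξ³ = 4as·(Ξ³/6)`. [cite: Markman2025SecantWeil, §8.1] -/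
theorem secantTwist_deg3 (a d : ℚ) :
    (-(a * d)) + 3 * (-d) * (-a) + 3 * a * a ^ 2 + 1 * (-a) ^ 3 = 2 * a * (a ^ 2 + d) := by ring

/-- Degree-4 coordinate: `c₄ + 4c₃(−a) + 6c₂a² + 4c₁(−a)³ + c₀a⁴ = −(a²+d)(3a²−d)`, so `ch₄(𝒪_V) = (s(3a²−d)/24)Ξ⁴`.
[cite: Markman2025SecantWeil, §8.1] -/
theorem secantTwist_deg4 (a d : ℚ) :
    d ^ 2 + 4 * (-(a * d)) * (-a) + 6 * (-d) * a ^ 2 + 4 * a * (-a) ^ 3 + 1 * a ^ 4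
      = -((a ^ 2 + d) * (3 * a ^ 2 - d)) := by ring

/-- Degree-5 coordinate: `c₅ + 5c₄(−a) + 10c₃a² + 10c₂(−a)³ + 5c₁a⁴ + c₀(−a)⁵ = 4a(a²+d)(a²−d)`, so
`ch₅(𝒪_V) = −(as(a²−d)/30)Ξ⁵` and `χ(𝒪_V) = ∫ch₅ = 4as(d − a²)` (`td P = 1`). New in dimension 5 (`Ξ⁵ ≠ 0`).
[cite: Markman2025SecantWeil, §8.1] -/
theorem secantTwist_deg5 (a d : ℚ) :
    a * d ^ 2 + 5 * d ^ 2 * (-a) + 10 * (-(a * d)) * a ^ 2 + 10 * (-d) * (-a) ^ 3 + 5 * a * a ^ 4 + 1 * (-a) ^ 5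
      = 4 * a * (a ^ 2 + d) * (a ^ 2 - d) := by ring

/-- Numerical dictionary, degree: `deg_Ξ V = Ξ³·[V] = (s/2)·Ξ⁵ = 60s`. [folklore] -/
theorem secantThreefold_degree (s : ℚ) : s / 2 * 120 = 60 * s := by ring

/-- Numerical dictionary, canonical degree: `K_V·Ξ|_V² = ∫ i_*K_V · Ξ² = (2as/3)·120 = 80as`. [folklore] -/
theorem secantThreefold_canonicalDegree (a s : ℚ) : 2 * a * s / 3 * 120 = 80 * a * s := by ring

/-- Numerical dictionary, holomorphic Euler characteristic: `χ(𝒪_V) = ∫ ch₅(𝒪_V) = −(as(a²−d)/30)·120 = 4as(d − a²)`. [folklore] -/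
theorem secantThreefold_chi (a d s : ℚ) : -(a * s * (a ^ 2 - d)) / 30 * 120 = 4 * a * s * (d - a ^ 2) := by ring

/-- Numerical dictionary, `K_V²·Ξ`: from `12·ch₄ = i_*(2K² − c₂N)` and `i_*c₂N = [V]² = (s²/4)Ξ⁴` one gets
`i_*K_V² = (s(3a²−d)/4 + s²/8)Ξ⁴`, so `K_V²·Ξ|_V = 30s(3a²−d) + 15s²`. [folklore] -/
theorem secantThreefold_KsqXi (a d s : ℚ) :
    (s * (3 * a ^ 2 - d) / 4 + s ^ 2 / 8) * 120 = 30 * s * (3 * a ^ 2 - d) + 15 * s ^ 2 := by ring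

/-- Consistency of the two middle entries: `12·(s(3a²−d)/24) = (2·(s(3a²−d)/4 + s²/8) − s²/4)`. [folklore] -/
theorem secantThreefold_ch4_consistency (a d s : ℚ) :
    12 * (s * (3 * a ^ 2 - d) / 24) = 2 * (s * (3 * a ^ 2 - d) / 4 + s ^ 2 / 8) - s ^ 2 / 4 := by ring

end SecantTwist

section Geography

/-- A smooth threefold `V` in a simple abelian fivefold is of general type with `K_V` nef and big, so `K_V·Ξ² = 80as > 0`;
with `s = a² + d > 0` this forces `a > 0`. [folklore] -/
theorem secantThreefold_a_pos (a s : ℤ) (hs : 0 < s) (h : 0 < 80 * a * s) : 0 < a := by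
  nlinarith

/-- Miyaoka's inequality for a smooth minimal threefold of general type gives `K_V·c₂(V) > 0`, i.e. `χ(𝒪_V) = 4as(d − a²) < 0`;
with `a, s > 0` this is `d < a²` — the same direction as the surface case (BMY, gen-2 Theorem G).
[cite: Miyaoka1987ChernClasses, Thm 1.1] -/
theorem secantThreefold_d_lt_sq (a d s : ℤ) (ha : 0 < a) (hs : 0 < s) (hchi : 4 * a * s * (d - a ^ 2) < 0) :
    d < a ^ 2 := by
  have h4 : 0 < 4 * a * s := by positivity
  by_contra hle
  have hle' : a ^ 2 ≤ d := not_lt.mp hle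
  have : 0 ≤ 4 * a * s * (d - a ^ 2) := mul_nonneg h4.le (by linarith)
  linarith

/-- Hence, ON MARKMAN'S PLANE `B_{√-dΞ}` (`a, d ∈ ℤ`), `a ≥ 2` and `s = a² + d ≥ 5`. (Over the full rational design space of
§5 below — all planes `B_w`, `w ∈ K ∖ ℚ`, normal form `(a', d') ∈ ℚ × ℚ_{>0}` — the bound drops to `s ≥ 3`: `rationalDesign_s_le_two_void`,
`rationalDesign_sThree`, `rationalDesign_sFour`.) [folklore] -/
theorem secantThreefold_s_ge_five (a d : ℤ) (ha : 0 < a) (hd : 1 ≤ d) (hda : d ≤ a ^ 2 - 1) :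
    2 ≤ a ∧ 5 ≤ a ^ 2 + d := by
  have ha2 : 2 ≤ a := by nlinarith
  refine ⟨ha2, ?_⟩
  nlinarith

/-- On Markman's plane (`a, d ∈ ℤ`), `s = 8` is impossible: `a = 2` gives `s ≤ 7`, `a ≥ 3` gives `s ≥ 10` (rational designs with
`s = 8` do exist: `(a', d') = (5/2, 7/4), (9/4, 47/16), (11/4, 7/16)`, §5). [folklore] -/
theorem secantThreefold_s_ne_eight (a d : ℤ) (ha : 0 < a) (hd : 1 ≤ d) (hda : d ≤ a ^ 2 - 1) : a ^ 2 + d ≠ 8 := by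
  intro h8
  rcases le_or_gt a 2 with h | h
  · have : a ^ 2 ≤ 4 := by nlinarith
    omega
  · have : 9 ≤ a ^ 2 := by nlinarith
    omega

/-- On Markman's plane (`a, d ∈ ℤ`), `s = 16` forces `(a,d) = (3,7)`, `K = ℚ(√-7)` (other planes add rational designs, §5).
[folklore] -/
theorem secantThreefold_s_sixteen (a d : ℤ) (ha : 0 < a) (hd : 1 ≤ d) (hda : d ≤ a ^ 2 - 1) (h : a ^ 2 + d = 16) :
    a = 3 ∧ d = 7 := by
  rcases le_or_gt a 2 with h2 | h2
  · have : a ^ 2 ≤ 4 := by nlinarith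
    omega
  rcases le_or_gt a 3 with h3 | h3
  · have ha3 : a = 3 := by omega
    subst ha3; omega
  · have : 16 ≤ a ^ 2 := by nlinarith
    omega

/-- On Markman's plane (`a, d ∈ ℤ`), `s = 32` forces `(a,d) = (5,7)`, again `K = ℚ(√-7)` (`a = 4` would need `d = 16 = a²`).
[folklore] -/
theorem secantThreefold_s_thirtytwo (a d : ℤ) (ha : 0 < a) (hd : 1 ≤ d) (hda : d ≤ a ^ 2 - 1) (h : a ^ 2 + d = 32) :
    a = 5 ∧ d = 7 := by
  rcases le_or_gt a 4 with h4 | h4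
  · have : a ^ 2 ≤ 16 := by nlinarith
    omega
  rcases le_or_gt a 5 with h5 | h5
  · have ha5 : a = 5 := by omega
    subst ha5; omega
  · have : 36 ≤ a ^ 2 := by nlinarith
    omega

/-- The Ramanujan–Nagell solutions `a² + 7 = 2^m` (`a = 1, 3, 5, 11, 181`; these are all of them [`Nagell1961`]) — the only way a
class `2^{m}·(Ξ²/2)` can be `ℚ(√-7)`-secant on Markman's plane (`a, d ∈ ℤ`); those with `7 < a²` (`m ≥ 4`) pass the geography of this
section. [cite: Nagell1961, Thm] -/
theorem ramanujanNagell_instances :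
    (1:ℤ) ^ 2 + 7 = 2 ^ 3 ∧ (3:ℤ) ^ 2 + 7 = 2 ^ 4 ∧ (5:ℤ) ^ 2 + 7 = 2 ^ 5 ∧ (11:ℤ) ^ 2 + 7 = 2 ^ 7 ∧
      (181:ℤ) ^ 2 + 7 = 2 ^ 15 := by
  norm_num

end Geography

section Tangent

/-- TANGENT IDENTITY, degree 2: with `b_i` the `θ^i`-coefficient of `e^{−θ}(1+θ)` (`b = (1, 0, −1/2, 1/3, −1/8, 1/30, …)`,
so that `ch(𝒪_{W_{g−2}}) = 1 − e^{−θ}(1+θ) = θ²/2 − θ³/3 + θ⁴/8 − θ⁵/30 + …` on a genus-`g` Jacobian, Poincaré's `[W_{g−2}] = θ²/2`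
[`ArbarelloEtAl1985`, I §5 and VII §5]) the `θ²`-coefficient of `e^{θ}·e^{−θ}(1+θ)` vanishes: `ch(𝓘_{W_{g−2}}(Θ)) = 1 + θ` has no
`θ²`-term. [cite: ArbarelloEtAl1985, VII §5] -/
theorem tangent_identity_deg2 : (1:ℚ) / 2 * 1 + 1 * 0 + 1 * (-1 / 2) = 0 := by norm_num

/-- Tangent identity, degree 3: `b₃ + b₂ + b₁/2 + b₀/6 = 0`. [cite: ArbarelloEtAl1985, VII §5] -/
theorem tangent_identity_deg3 : (1:ℚ) / 3 + (-1 / 2) + 0 / 2 + 1 / 6 = 0 := by norm_num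

/-- Tangent identity, degree 4: `b₄ + b₃ + b₂/2 + b₁/6 + b₀/24 = 0`. [cite: ArbarelloEtAl1985, VII §5] -/
theorem tangent_identity_deg4 : (-1:ℚ) / 8 + 1 / 3 + (-1 / 2) / 2 + 0 / 6 + 1 / 24 = 0 := by norm_num

/-- Tangent identity, degree 5: `b₅ + b₄ + b₃/2 + b₂/6 + b₁/24 + b₀/120 = 0`; so through dimension 5,
`ch(𝓘_{W_{g−2}} ⊗ 𝒪(Θ)) = 1 + θ` = the point `e^{0·θ}` plus the tangent vector `θ` of the spinor curve: `W_{g−2}` (genus 3: the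
Abel–Jacobi curve) is a TANGENT object, the member `d = 0` of the secant family `α_d + aβ_d = 1 + aθ − dθ²/2 − …`.
[cite: ArbarelloEtAl1985, VII §5] -/
theorem tangent_identity_deg5 :
    (1:ℚ) / 30 + (-1 / 8) + (1 / 3) / 2 + (-1 / 2) / 6 + 0 / 24 + 1 / 120 = 0 := by norm_num

/-- The closed form used above is the `c = 2` case of `ch(𝒪_{W_{g−c}}) = Σ_{k ≥ c} (−1)^{k−c}·C(k−1, c−1)·θ^k/k!`:
`C(k−1, 1) = k − 1` and `(−1)^{k−2} = (−1)^k`, i.e. the `θ^k/k!`-coordinate is `(−1)^k (k−1)`, which is `k!·(−b_k)`: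
`2!·(1/2) = 1`, `3!·(−1/3) = −2`, `4!·(1/8) = 3`, `5!·(−1/30) = −4`. [cite: ArbarelloEtAl1985, VII §5] -/
theorem chOW_codimTwo_coords :
    (2:ℚ) * (1 / 2) = 1 ∧ (6:ℚ) * (-1 / 3) = -2 ∧ (24:ℚ) * (1 / 8) = 3 ∧ (120:ℚ) * (-1 / 30) = -4 := by norm_num

/-- Markman's genus-3 sheaf as a sum of tangents: for `d + 1` disjoint Abel–Jacobi curves on a genus-3 Jacobian (`θ⁴ = 0`),
`ch(𝓘_{∪C_i}(Θ)) = e^{θ}(1 − (d+1)(θ²/2 − θ³/3))` has `θ^k/k!`-coordinates `(1, 1, −d, −d)` = those of `α_d + β_d` — the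
degree-2 and degree-3 coordinate identities. [cite: Markman2025SecantWeil, Example 8.2.3] -/
theorem genusThree_sum_of_tangents (d : ℚ) :
    2 * (1 / 2 - (d + 1) * (1 / 2)) = -d ∧ 6 * (1 / 6 - (d + 1) * (1 / 2) + (d + 1) * (1 / 3)) = -d := by
  constructor <;> ring

/-- One rung up the same recipe fails already numerically: in dimension `≥ 4` the degree-4 coordinate of
`e^{θ}(1 − (d+1)(1 − e^{−θ}(1+θ))) = (d+1)(1+θ) − d·e^{θ}` is `−d`, not the secant value `+d²` (equal only for `d ∈ {0, −1}`).
[cite: Markman2025SecantWeil, Example 8.2.3] -/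
theorem sum_of_tangents_fails_deg4 (d : ℚ) (hd : 0 < d) : -d ≠ d ^ 2 := by
  intro h; nlinarith

/-- The Prym–Brill–Noether threefold `V₉ = W̃₉ ∩ P` in a Prym fivefold `P = Prym(C̃/C)`, `g(C) = 6`, `g̃ = 11`, `θ̃|_P = 2Ξ`:
`ch(𝒪_{V₉}) = 1 − e^{−2Ξ}(1 + 2Ξ)` has `Ξ^k`-coefficients `−2^k b_k = (2, −8/3, 2, −16/15)` (`k = 2..5`), and these ARE the required
secant coefficients `(s/2, −as/3, s(3a²−d)/24, −as(a²−d)/30)` at `(a, d, s) = (2, 0, 4)`: `𝓘_{V₉}(2Ξ)` is a tangent sheaf,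
`ch = 1 + 2Ξ`. [cite: ArbarelloEtAl1985, VII §5] -/
theorem prymBN_threefold_tangent :
    (-(2:ℚ) ^ 2 * (-1 / 2) = 2 ∧ -(2:ℚ) ^ 3 * (1 / 3) = -8 / 3 ∧ -(2:ℚ) ^ 4 * (-1 / 8) = 2 ∧
        -(2:ℚ) ^ 5 * (1 / 30) = -16 / 15) ∧
      ((4:ℚ) / 2 = 2 ∧ -(2 * 4 : ℚ) / 3 = -8 / 3 ∧ (4:ℚ) * (3 * 2 ^ 2 - 0) / 24 = 2 ∧
        -(2 * 4 * (2 ^ 2 - 0) : ℚ) / 30 = -16 / 15) := by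
  norm_num

/-- … and for NO imaginary quadratic field: if `a² + d = 4` (the class `2Ξ²`) and the degree-3 coefficient matches,
`−a(a²+d)/3 = −8/3`, then `a = 2` and `d = 0`. The Prym–Brill–Noether threefold is not `K`-secant for any `d > 0`
(for any twist `a ∈ ℚ`). [folklore] -/
theorem prymBN_threefold_not_secant (a d : ℚ) (hs : a ^ 2 + d = 4) (h3 : -(a * (a ^ 2 + d)) / 3 = -8 / 3) :
    a = 2 ∧ d = 0 := by
  rw [hs] at h3
  have ha : a = 2 := by linarith
  subst ha
  constructor
  · rfl
  · linarith

end Tangent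

section CMDisjoint

/-- Two generic translates of codimension-2 subvarieties of an abelian `n`-fold meet in dimension `2(n−2) − n = n − 4` when
`n ≥ 4`, whereas a Cohen–Macaulay scheme is connected in codimension one [`Hartshorne1962`], so a CM union of two codimension-2
pieces must meet in dimension `≥ (n−2) − 1 = n − 3`: `n − 4 < n − 3`. Hence for `n ≥ 4` a union of generic translates of
codimension-2 subvarieties is never CM at the intersection — `pd 𝓘 ≥ 2` there, the local Poisson obstruction of the ladder's
Theorem E bites. [cite: Hartshorne1962, Thm 2.2] -/
theorem cm_union_needs_le_three (n : ℕ) (hn : 4 ≤ n) : 2 * (n - 2) - n < (n - 2) - 1 := by omega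

/-- … while for `2 ≤ n ≤ 3` generic translates are DISJOINT (`2(n−2) < n`), so the union is trivially CM: the recipe
"`K`-secant sheaf = ideal of `a² + d` disjoint translates of a tangent object, twisted by `𝒪(aΘ)`" exists exactly in Markman's
genus 3 (and trivially in genus 2). [folklore] -/
theorem translates_disjoint_iff_le_three (n : ℕ) (hn : 2 ≤ n) : 2 * (n - 2) < n ↔ n ≤ 3 := by omega

/-- The count Lemma 8.3.4 asks of an irreducible design on an abelian fivefold: `dim HT²(P) = 2n² − n = 45`, `dim ann(ch F) = n² = 25`
(`n = 5`, tree `secantSystem_iff`), so `ev` onto `Ext²` with kernel `ann` needs `e₂ = 20`; for `F = 𝓘_V(aΞ)` with `V` smooth of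
codimension 2 the local-to-global sequence gives `e₂ = h²(𝒪_P) + h¹(N_V) − rk d₂ = 10 + h − r`, so the requirement is `h − r = 10`.
[cite: Markman2025SecantWeil, Lemma 8.3.4] -/
theorem lemma834_count_five (h r : ℕ) (hr : r ≤ h) :
    (2 * 5 ^ 2 - 5 - 5 ^ 2 = 20) ∧ (10 + h - r = 20 ↔ h - r = 10) := by
  constructor
  · norm_num
  · omega

end CMDisjoint

section RationalDesigns

/-- Newton's identities with `c₁ = 0`: in units of the minimal classes `Ξ^k/k!` the Chern classes of `𝓘_V` (`ch(𝓘_V) = 1 − ch(𝒪_V)`,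
power sums `p₂ = −s`, `p₃ = 2a's`, `p₄ = −s(3a'²−d')`, `p₅ = 4a's(a'²−d')`) are `c₂ = s`, `c₃ = 4a's`, `c₄ = 3s² + 6s(3a'²−d')`,
`c₅ = 40a's² + 96a's(a'²−d')` — the four identities `k!·c_k(Newton) = (stated)`. Valid for rational `(a', d')`. [folklore] -/
theorem secantThreefold_chernClasses (a d s : ℚ) :
    2 * (-(-s) / 2) = s ∧
    6 * (2 * a * s / 3) = 4 * a * s ∧
    24 * ((-(s / 2) * (-s) - (-(s * (3 * a ^ 2 - d)))) / 4) = 3 * s ^ 2 + 6 * s * (3 * a ^ 2 - d) ∧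
    120 * ((-(2 * a * s / 3) * (-s) + s / 2 * (2 * a * s) + 4 * a * s * (a ^ 2 - d)) / 5)
      = 40 * a * s ^ 2 + 96 * a * s * (a ^ 2 - d) := by
  refine ⟨by ring, by ring, by ring, by ring⟩

/-- With `m := 4a's = c₃ ∈ ℤ` and `d' = s − a'²`: `χ(𝒪_V) = 4a's(d' − a'²) = ms − m³/(8s²)` and `c₅ = 10ms − (24ms − 3m³/s²)`,
`c₄ = 3s² + 6s(4a'² − s) = −3s² + 3m²/(2s)`; so integrality of `χ, c₄, c₅` reads `8s² ∣ m³`, `2s ∣ 3m²`, `s² ∣ 3m³`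
(as divisibilities of integers). The three algebraic identities, for `s ≠ 0`: [folklore] -/
theorem rationalDesign_integrality_forms (m s : ℚ) (hs : s ≠ 0) :
    4 * (m / (4 * s)) * s * ((s - (m / (4 * s)) ^ 2) - (m / (4 * s)) ^ 2) = m * s - m ^ 3 / (8 * s ^ 2) ∧
    3 * s ^ 2 + 6 * s * (3 * (m / (4 * s)) ^ 2 - (s - (m / (4 * s)) ^ 2)) = -3 * s ^ 2 + 3 * m ^ 2 / (2 * s) ∧
    40 * (m / (4 * s)) * s ^ 2 + 96 * (m / (4 * s)) * s * ((m / (4 * s)) ^ 2 - (s - (m / (4 * s)) ^ 2))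
      = 10 * m * s - 24 * m * s + 3 * m ^ 3 / s ^ 2 := by
  refine ⟨?_, ?_, ?_⟩ <;> field_simp <;> ring

/-- `s = 1`: the window `a'² ∈ (s/2, s)` is `8 < m² < 16`, i.e. `m = ±3`, and `8 ∤ 27`: no rational rank-one secant threefold design
with ONE minimal class (for any `K`). [folklore] -/
theorem rationalDesign_sOne_void (m : ℤ) (h1 : 8 < m ^ 2) (h2 : m ^ 2 < 16) : ¬ (8 : ℤ) ∣ m ^ 3 := by
  have hm : m = 3 ∨ m = -3 := by
    have : m ≤ 3 := by nlinarith
    have : -3 ≤ m := by nlinarith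
    interval_cases m <;> simp_all
  rcases hm with rfl | rfl <;> decide

/-- `s = 2`: `64 < m² < 128`, i.e. `|m| ∈ {9, 10, 11}`, and `8s² = 32` divides none of `729, 1000, 1331`: no design with TWO minimal
classes — in particular Beauville's `e = 8` special threefold (class `Ξ²`) is not `K`-secant for any `K` and any plane. [folklore] -/
theorem rationalDesign_sTwo_void (m : ℤ) (h1 : 64 < m ^ 2) (h2 : m ^ 2 < 128) : ¬ (32 : ℤ) ∣ m ^ 3 := by
  have : m ≤ 11 := by nlinarith
  have : -11 ≤ m := by nlinarith
  interval_cases m <;> simp_all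

/-- `s = 3`: `216 < m² < 432` and `8s² = 72 ∣ m³` force `m = ±18`, i.e. `a' = m/(4s) = 3/2`, `d' = 3 − 9/4 = 3/4`, `K = ℚ(√-3)`
(principal plane, `w ≡ ω₃ = (1+√-3)/2`): the unique rational design with THREE minimal classes. [folklore] -/
theorem rationalDesign_sThree_unique (m : ℤ) (h1 : 216 < m ^ 2) (h2 : m ^ 2 < 432) (h3 : (72 : ℤ) ∣ m ^ 3) :
    m = 18 ∨ m = -18 := by
  have : m ≤ 20 := by nlinarith
  have : -20 ≤ m := by nlinarith
  interval_cases m <;> simp_all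

/-- The `s = 3` design: `(a', d') = (3/2, 3/4)`, `s = 3`, Chern classes `(c₂, c₃, c₄, c₅) = (3, 18, 135, 1188)` (minimal units), all
integral, `χ(𝒪_V) = −27`, `i_*K_V = 18·(Ξ³/6) = 3Ξ³`, `K_V·Ξ² = 360 = 2·deg_Ξ V`, `deg_Ξ V = 180`. [folklore] -/
theorem rationalDesign_sThree :
    ((3:ℚ) / 2) ^ 2 + 3 / 4 = 3 ∧ 4 * ((3:ℚ) / 2) * 3 = 18 ∧
    3 * (3:ℚ) ^ 2 + 6 * 3 * (3 * (3 / 2) ^ 2 - 3 / 4) = 135 ∧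
    40 * ((3:ℚ) / 2) * 3 ^ 2 + 96 * (3 / 2) * 3 * ((3 / 2) ^ 2 - 3 / 4) = 1188 ∧
    4 * ((3:ℚ) / 2) * 3 * (3 / 4 - (3 / 2) ^ 2) = -27 ∧ 80 * ((3:ℚ) / 2) * 3 = 360 ∧ (60:ℚ) * 3 = 180 := by
  norm_num

/-- `s = 4`: `512 < m² < 1024` and `8s² = 128 ∣ m³` force `m = ±24`, i.e. `a' = 3/2`, `d' = 4 − 9/4 = 7/4`, `K = ℚ(√-7)` (principal
plane, `w ≡ ω₇ = (1+√-7)/2`): the unique rational design with FOUR minimal classes — the class `2Ξ²` of the Prym–Brill–Noether threefold.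
[folklore] -/
theorem rationalDesign_sFour_unique (m : ℤ) (h1 : 512 < m ^ 2) (h2 : m ^ 2 < 1024) (h3 : (128 : ℤ) ∣ m ^ 3) :
    m = 24 ∨ m = -24 := by
  have : m ≤ 31 := by nlinarith
  have : -31 ≤ m := by nlinarith
  interval_cases m <;> simp_all

/-- The `s = 4` design: `(a', d') = (3/2, 7/4)`, Chern classes `(4, 24, 168, 1248)`, `χ(𝒪_V) = −12`, `i_*K_V = 24·(Ξ³/6) = 4Ξ³`,
`K_V·Ξ² = 480`, `deg_Ξ V = 240`; versus the actual Prym–Brill–Noether threefold in the same class: `i_*K_{V₉} = −2·(−8/3)Ξ³ =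
32·(Ξ³/6)`, `χ(𝒪_{V₉}) = 120·(−16/15) = −128`. [folklore] -/
theorem rationalDesign_sFour :
    ((3:ℚ) / 2) ^ 2 + 7 / 4 = 4 ∧ 4 * ((3:ℚ) / 2) * 4 = 24 ∧
    3 * (4:ℚ) ^ 2 + 6 * 4 * (3 * (3 / 2) ^ 2 - 7 / 4) = 168 ∧
    40 * ((3:ℚ) / 2) * 4 ^ 2 + 96 * (3 / 2) * 4 * ((3 / 2) ^ 2 - 7 / 4) = 1248 ∧
    4 * ((3:ℚ) / 2) * 4 * (7 / 4 - (3 / 2) ^ 2) = -12 ∧ 80 * ((3:ℚ) / 2) * 4 = 480 ∧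
    (-2 * (-(8:ℚ) / 3) * 6 = 32 ∧ (120:ℚ) * (-16 / 15) = -128) := by
  norm_num

/-- A non-principal plane: `(a', d') = (7/4, 15/16)`, `s = 4`, `K = ℚ(√-15)` (lattice `ℤ + ℤ(−7+√-15)/4`, binary form
`2x² − xy + 2y²`, the non-trivial ideal class): `c₂..c₄ = (4, 28, 246)` integral (an admissible SURFACE design in an abelian
fourfold, `χ(𝒪_S) = (3a'²−d')s = 33`, `K_S² = 3s(7a'²−d') = 246`), but `χ(𝒪_V) = 4a's(d'−a'²) = −119/2 ∉ ℤ` for threefolds.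
[folklore] -/
theorem rationalDesign_sFour_sqrt15 :
    ((7:ℚ) / 4) ^ 2 + 15 / 16 = 4 ∧ 4 * ((7:ℚ) / 4) * 4 = 28 ∧
    3 * (4:ℚ) ^ 2 + 6 * 4 * (3 * (7 / 4) ^ 2 - 15 / 16) = 246 ∧
    (3 * ((7:ℚ) / 4) ^ 2 - 15 / 16) * 4 = 33 ∧ 3 * (4:ℚ) * (7 * (7 / 4) ^ 2 - 15 / 16) = 246 ∧
    4 * ((7:ℚ) / 4) * 4 * (15 / 16 - (7 / 4) ^ 2) = -119 / 2 := by
  norm_num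

end RationalDesigns

end Literature.AlgebraicGeometry.HodgeTheory
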